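import Summits.Ventures.Crystal3D.Theorems.StickyWulffConstantCoaxialWallLawJammedBall
import Summits.Ventures.Crystal3D.Theorems.StickyWulffConstantCoaxialWallLawMenuWindowFrames
import Summits.Ventures.Crystal3D.Theorems.StickyWulffConstantCoaxialWallLawEndRowCoaxialModuleMenu
import Summits.Ventures.Crystal3D.Theorems.StickyWulffConstantCoaxialWallLawReaderTriangles
import Summits.Ventures.Crystal3D.Theorems.StickyWulffConstantGenericWallFloorEndBallDefectSite
import HarnessLib

/-!
# ONE JAMMED BALL OVER A MODULE WINDOW, I: the class frame of every reader is `D₊` or `D₋`, mirrored slots stay on the module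
# (crux `CoaxialWallLaw`, stmt-Ventures-19481, line `WallLedgerF`; census-free bricks for the U-A1 stub `JammedOneSmall` of `…TailResidueDefsU`)

HONEST FRAMING. Venture `Summits/Ventures/Crystal3D` (cell `crystal3d-full`), helper `--supports` the crux `CoaxialWallLaw` of
`route-Ventures-StickyWulffConstant` (REGISTERED line `WallLedgerF`, skeleton 'CoaxialWallLawCertificates' v4; v5 texts `…TailResidueDefsU`:
`stub_jammedOneSmall : TailResidue.JammedOneSmall (2√6) 3`).  Rung credit only; F-C1 not moved; census-free.
`…JammedBall` compared `X` with `X.erase x` for a ball `x` of `≤ 3` contacts under the ABSTRACT hypothesis «`x` sits at no inspected position»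
(`InspectedAt`: every dozen and mirrored-dozen position of every class frame).  That hypothesis is too strong for the U-A1 shape — an off-module
ball may sit at a mirrored-dozen position of an inclined menu normal without ever being read.  This file and `…JammedComparison` prove the
comparison from the GEOMETRY of the shape instead (model position, payer `0`): every ball of the window within `3` of the payer other than `x`
lies on the coaxial module, `x` is OFF the module, and `x` is NOT CAPPING (it does not touch three pairwise touching balls — a capping ball sits
at a first-generation apex position and belongs to the mono-module regime of `ModuleCapture`/`MonoCapture`).
* module bookkeeping: `sub_mem_module`, `add_mem_module`, `neg_mem_module`, `slot_mem_module`, `basalMirror_mem_module`,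
  `basalMirror_slot_mem_module`, `menu_mem_module`, `slots_mem_module_of_image`, `ne_of_mem_module`;
* `menu_of_triangle` — an occupied slot triangle of a ball `q ≠ x` within `2` of the payer avoids `x` (non-capping), so its slot images are
  menu vectors (`coaxialModule_neighbour_mem`);
* **`image_eq_of_reader`**, **`slots_mem_module_of_reader`** — the class frame of every reader `q ≠ x` within `2` of the payer has
  `G '' fccSlots = D₊` or `= D₋` (`exists_contact_triangle_of_isEndMove` + `face_pure_of_neighbourMenu` + `image_fccSlots_eq_of_triangle`),
  so all twelve slot images are module vectors;
* **`mirror_mem_module_of_twinReading`** — for a twin reading that FIRES at such a reader, all twelve mirrored slots `G w − 2⟪G w, m⟫ m` are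
  module vectors as well (its three mirror balls avoid `x` by non-capping; in-plane slots are fixed; the upper triple is minus the lower one).
WHAT THIS IS NOT: not the comparison (part II), not the census, not the stub; F-C1 not moved.
-/

noncomputable section

namespace Summit.Ventures.Crystal3D.Theorems

namespace TailResidue

open Summit.Ventures.Crystal3D Finset
open Literature.MathematicalPhysics.StatisticalMechanics (basalMirror basalMirror_apply_coord triangularVec₁ triangularVec₂ barlowOffset
  layerNormal constHagg)
open scoped InnerProductSpace

/-! ### Module bookkeeping (the coaxial module is an additive subgroup containing `D₊ ∪ D₋`) -/

/-- Differences of module points are module vectors. -/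
theorem sub_mem_module {p q : EuclideanSpace ℝ (Fin 3)} (hp : p ∈ coaxialModule 1 (Real.sqrt (2 / 3)))
    (hq : q ∈ coaxialModule 1 (Real.sqrt (2 / 3))) : p - q ∈ coaxialModule 1 (Real.sqrt (2 / 3)) := by
  obtain ⟨i, j, n, k, rfl⟩ := hp
  obtain ⟨i', j', n', k', rfl⟩ := hq
  refine ⟨i - i', j - j', n - n', k - k', ?_⟩
  push_cast
  module

/-- Sums of module vectors are module vectors. -/
theorem add_mem_module {p q : EuclideanSpace ℝ (Fin 3)} (hp : p ∈ coaxialModule 1 (Real.sqrt (2 / 3)))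
    (hq : q ∈ coaxialModule 1 (Real.sqrt (2 / 3))) : p + q ∈ coaxialModule 1 (Real.sqrt (2 / 3)) := by
  obtain ⟨i, j, n, k, rfl⟩ := hp
  obtain ⟨i', j', n', k', rfl⟩ := hq
  refine ⟨i + i', j + j', n + n', k + k', ?_⟩
  push_cast
  module

/-- Negatives of module vectors are module vectors. -/
theorem neg_mem_module {p : EuclideanSpace ℝ (Fin 3)} (hp : p ∈ coaxialModule 1 (Real.sqrt (2 / 3))) :
    -p ∈ coaxialModule 1 (Real.sqrt (2 / 3)) := by
  obtain ⟨i, j, n, k, rfl⟩ := hp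
  refine ⟨-i, -j, -n, -k, ?_⟩
  push_cast
  module

/-- The slots of `D₊` are module vectors. -/
theorem slot_mem_module {w : EuclideanSpace ℝ (Fin 3)} (hw : w ∈ fccSlots) : w ∈ coaxialModule 1 (Real.sqrt (2 / 3)) :=
  barlowStacking_subset_coaxialModule 1 (Real.sqrt (2 / 3)) constHagg (mem_fcc_of_mem_fccSlots hw)

/-- The basal mirror maps the module onto itself. -/
theorem basalMirror_mem_module {p : EuclideanSpace ℝ (Fin 3)} (hp : p ∈ coaxialModule 1 (Real.sqrt (2 / 3))) :
    basalMirror p ∈ coaxialModule 1 (Real.sqrt (2 / 3)) := by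
  obtain ⟨i, j, n, k, rfl⟩ := hp
  refine ⟨i, j, n, -k, ?_⟩
  ext t
  rw [basalMirror_apply_coord]
  fin_cases t <;> simp [triangularVec₁, triangularVec₂, barlowOffset, layerNormal]

/-- The slots of `D₋` are module vectors. -/
theorem basalMirror_slot_mem_module {y : EuclideanSpace ℝ (Fin 3)}
    (hy : y ∈ (basalMirror : EuclideanSpace ℝ (Fin 3) → EuclideanSpace ℝ (Fin 3)) '' ↑fccSlots) :
    y ∈ coaxialModule 1 (Real.sqrt (2 / 3)) := by
  obtain ⟨w, hw, rfl⟩ := hy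
  exact basalMirror_mem_module (slot_mem_module (mem_coe.1 hw))

/-- Menu vectors (`D₊ ∪ D₋`) are module vectors. -/
theorem menu_mem_module {y : EuclideanSpace ℝ (Fin 3)}
    (hy : y ∈ fccSlots ∨ y ∈ (basalMirror : EuclideanSpace ℝ (Fin 3) → EuclideanSpace ℝ (Fin 3)) '' ↑fccSlots) :
    y ∈ coaxialModule 1 (Real.sqrt (2 / 3)) := by
  rcases hy with hy | hy
  · exact slot_mem_module hy
  · exact basalMirror_slot_mem_module hy

/-- If `G '' fccSlots = D₊` or `= D₋` then every slot image is a module vector. -/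
theorem slots_mem_module_of_image {G : EuclideanSpace ℝ (Fin 3) ≃ₗᵢ[ℝ] EuclideanSpace ℝ (Fin 3)}
    (h : (G : EuclideanSpace ℝ (Fin 3) → EuclideanSpace ℝ (Fin 3)) '' ↑fccSlots = ↑fccSlots ∨
      (G : EuclideanSpace ℝ (Fin 3) → EuclideanSpace ℝ (Fin 3)) '' ↑fccSlots =
        (basalMirror : EuclideanSpace ℝ (Fin 3) → EuclideanSpace ℝ (Fin 3)) '' ↑fccSlots) :
    ∀ w ∈ fccSlots, G w ∈ coaxialModule 1 (Real.sqrt (2 / 3)) := by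
  intro w hw
  have hmem : G w ∈ (G : EuclideanSpace ℝ (Fin 3) → EuclideanSpace ℝ (Fin 3)) '' ↑fccSlots := ⟨w, mem_coe.2 hw, rfl⟩
  rcases h with h | h
  · rw [h] at hmem; exact slot_mem_module (mem_coe.1 hmem)
  · rw [h] at hmem; exact basalMirror_slot_mem_module hmem


/-- A point of the module is not the off-module ball. -/
theorem ne_of_mem_module {x p : EuclideanSpace ℝ (Fin 3)} (hxoff : x ∉ coaxialModule 1 (Real.sqrt (2 / 3)))
    (hp : p ∈ coaxialModule 1 (Real.sqrt (2 / 3))) : p ≠ x := fun h => hxoff (h ▸ hp)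

/-! ### The jammed window in model position -/

section Window

variable {Y : Finset (EuclideanSpace ℝ (Fin 3))} {x : EuclideanSpace ℝ (Fin 3)} {v : WordVersion}
  (hmod : ∀ y ∈ Y, dist (0 : EuclideanSpace ℝ (Fin 3)) y ≤ 3 → y ≠ x → y ∈ coaxialModule 1 (Real.sqrt (2 / 3)))
  (hxoff : x ∉ coaxialModule 1 (Real.sqrt (2 / 3)))
  (hcap : ∀ t₁ ∈ Y, ∀ t₂ ∈ Y, ∀ t₃ ∈ Y, dist t₁ t₂ = 1 → dist t₁ t₃ = 1 → dist t₂ t₃ = 1 →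
    dist x t₁ = 1 → dist x t₂ = 1 → dist x t₃ = 1 → False)

include hmod hcap in
/-- **An occupied slot triangle of a ball `q ≠ x` within `2` of the payer avoids `x`** (non-capping), so its three balls are module points
and its three slot images are menu vectors. -/
theorem menu_of_triangle {q : EuclideanSpace ℝ (Fin 3)} (hq : q ∈ Y) (hqx : q ≠ x) (hq2 : dist (0 : EuclideanSpace ℝ (Fin 3)) q ≤ 2)
    (G : EuclideanSpace ℝ (Fin 3) ≃ₗᵢ[ℝ] EuclideanSpace ℝ (Fin 3)) {u₁ u₂ u₃ : EuclideanSpace ℝ (Fin 3)}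
    (hu₁ : u₁ ∈ fccSlots) (hu₂ : u₂ ∈ fccSlots) (hu₃ : u₃ ∈ fccSlots)
    (h12 : ⟪u₁, u₂⟫_ℝ = 1 / 2) (h13 : ⟪u₁, u₃⟫_ℝ = 1 / 2) (h23 : ⟪u₂, u₃⟫_ℝ = 1 / 2)
    (o1 : q + G u₁ ∈ Y) (o2 : q + G u₂ ∈ Y) (o3 : q + G u₃ ∈ Y) :
    (G u₁ ∈ fccSlots ∨ G u₁ ∈ (basalMirror : EuclideanSpace ℝ (Fin 3) → EuclideanSpace ℝ (Fin 3)) '' ↑fccSlots) ∧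
    (G u₂ ∈ fccSlots ∨ G u₂ ∈ (basalMirror : EuclideanSpace ℝ (Fin 3) → EuclideanSpace ℝ (Fin 3)) '' ↑fccSlots) ∧
    (G u₃ ∈ fccSlots ∨ G u₃ ∈ (basalMirror : EuclideanSpace ℝ (Fin 3) → EuclideanSpace ℝ (Fin 3)) '' ↑fccSlots) := by
  have hqM : q ∈ coaxialModule 1 (Real.sqrt (2 / 3)) := hmod q hq (by linarith) hqx
  have h21 : ⟪u₂, u₁⟫_ℝ = 1 / 2 := by rw [real_inner_comm]; exact h12
  have h31 : ⟪u₃, u₁⟫_ℝ = 1 / 2 := by rw [real_inner_comm]; exact h13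
  have h32 : ⟪u₃, u₂⟫_ℝ = 1 / 2 := by rw [real_inner_comm]; exact h23
  -- non-capping: none of the three triangle balls is `x`
  have key : ∀ {a b c : EuclideanSpace ℝ (Fin 3)}, a ∈ fccSlots → b ∈ fccSlots → c ∈ fccSlots →
      ⟪a, b⟫_ℝ = 1 / 2 → ⟪a, c⟫_ℝ = 1 / 2 → ⟪b, c⟫_ℝ = 1 / 2 → q + G b ∈ Y → q + G c ∈ Y → q + G a ≠ x := by
    intro a b c ha hb hc hab hac hbc hob hoc h
    refine hcap q hq (q + G b) hob (q + G c) hoc (dist_slotSite_eq_one G q hb) (dist_slotSite_eq_one G q hc)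
      (dist_frame_slots_eq_one G q hb hc hbc) ?_ ?_ ?_
    · rw [← h, dist_comm]; exact dist_slotSite_eq_one G q ha
    · rw [← h]; exact dist_frame_slots_eq_one G q ha hb hab
    · rw [← h]; exact dist_frame_slots_eq_one G q ha hc hac
  have ne1 : q + G u₁ ≠ x := key hu₁ hu₂ hu₃ h12 h13 h23 o2 o3
  have ne2 : q + G u₂ ≠ x := key hu₂ hu₁ hu₃ h21 h23 h13 o1 o3
  have ne3 : q + G u₃ ≠ x := key hu₃ hu₁ hu₂ h31 h32 h12 o1 o2
  have far : ∀ {u : EuclideanSpace ℝ (Fin 3)}, u ∈ fccSlots → dist (0 : EuclideanSpace ℝ (Fin 3)) (q + G u) ≤ 3 := by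
    intro u hu
    linarith [dist_triangle (0 : EuclideanSpace ℝ (Fin 3)) q (q + G u), dist_slotSite_eq_one G q hu]
  have menu : ∀ {u : EuclideanSpace ℝ (Fin 3)}, u ∈ fccSlots → q + G u ∈ Y → q + G u ≠ x →
      G u ∈ fccSlots ∨ G u ∈ (basalMirror : EuclideanSpace ℝ (Fin 3) → EuclideanSpace ℝ (Fin 3)) '' ↑fccSlots := by
    intro u hu ho hne
    have := coaxialModule_neighbour_mem hqM (hmod _ ho (far hu) hne) (dist_slotSite_eq_one G q hu)
    rwa [add_sub_cancel_left] at this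
  exact ⟨menu hu₁ o1 ne1, menu hu₂ o2 ne2, menu hu₃ o3 ne3⟩

include hmod hcap in
/-- **THE FRAME OF EVERY READER OF THE JAMMED WINDOW IS `D₊` OR `D₋`**: for a reader `q ≠ x` within `2` of the payer, the class frame of any
end move satisfies `G '' fccSlots = fccSlots` or `= basalMirror '' fccSlots`. -/
theorem image_eq_of_reader {q : EuclideanSpace ℝ (Fin 3)} (hq : q ∈ Y) (hqx : q ≠ x) (hq2 : dist (0 : EuclideanSpace ℝ (Fin 3)) q ≤ 2)
    {G : EuclideanSpace ℝ (Fin 3) ≃ₗᵢ[ℝ] EuclideanSpace ℝ (Fin 3)} {d b : EuclideanSpace ℝ (Fin 3)} (hmove : IsEndMove Y v G d q b) :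
    (G : EuclideanSpace ℝ (Fin 3) → EuclideanSpace ℝ (Fin 3)) '' ↑fccSlots = ↑fccSlots ∨
      (G : EuclideanSpace ℝ (Fin 3) → EuclideanSpace ℝ (Fin 3)) '' ↑fccSlots =
        (basalMirror : EuclideanSpace ℝ (Fin 3) → EuclideanSpace ℝ (Fin 3)) '' ↑fccSlots := by
  obtain ⟨u₁, hu₁, u₂, hu₂, u₃, hu₃, h12, h13, h23, o1, o2, o3⟩ := exists_contact_triangle_of_isEndMove hmove
  obtain ⟨m1, m2, m3⟩ := menu_of_triangle hmod hcap hq hqx hq2 G hu₁ hu₂ hu₃ h12 h13 h23 o1 o2 o3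
  have hG12 : ⟪G u₁, G u₂⟫_ℝ = 1 / 2 := by rw [LinearIsometryEquiv.inner_map_map, h12]
  have hG13 : ⟪G u₁, G u₃⟫_ℝ = 1 / 2 := by rw [LinearIsometryEquiv.inner_map_map, h13]
  have hG23 : ⟪G u₂, G u₃⟫_ℝ = 1 / 2 := by rw [LinearIsometryEquiv.inner_map_map, h23]
  rcases face_pure_of_neighbourMenu m1 m2 m3 hG12 hG13 hG23 with ⟨f1, f2, f3⟩ | ⟨f1, f2, f3⟩
  · left
    have hrefl : ((LinearIsometryEquiv.refl ℝ (EuclideanSpace ℝ (Fin 3)) :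
        EuclideanSpace ℝ (Fin 3) → EuclideanSpace ℝ (Fin 3)) '' ↑fccSlots) = ↑fccSlots := by
      simp
    have key := image_fccSlots_eq_of_triangle G (LinearIsometryEquiv.refl ℝ _) hu₁ hu₂ hu₃ h12 h13 h23
      (by rw [hrefl]; exact mem_coe.2 f1) (by rw [hrefl]; exact mem_coe.2 f2) (by rw [hrefl]; exact mem_coe.2 f3)
    rwa [hrefl] at key
  · right
    exact image_fccSlots_eq_of_triangle G basalMirror hu₁ hu₂ hu₃ h12 h13 h23 f1 f2 f3

include hmod hcap in
/-- **Every slot image of a reader's class frame is a module vector.** -/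
theorem slots_mem_module_of_reader {q : EuclideanSpace ℝ (Fin 3)} (hq : q ∈ Y) (hqx : q ≠ x)
    (hq2 : dist (0 : EuclideanSpace ℝ (Fin 3)) q ≤ 2) {G : EuclideanSpace ℝ (Fin 3) ≃ₗᵢ[ℝ] EuclideanSpace ℝ (Fin 3)}
    {d b : EuclideanSpace ℝ (Fin 3)} (hmove : IsEndMove Y v G d q b) :
    ∀ w ∈ fccSlots, G w ∈ coaxialModule 1 (Real.sqrt (2 / 3)) :=
  slots_mem_module_of_image (image_eq_of_reader hmod hcap hq hqx hq2 hmove)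

include hmod hcap in
/-- **The mirrored slots of a FIRING twin reading are module vectors**: if `q ≠ x` within `2` of the payer twin-reads `(G, m)` and the slot images
of `G` are module vectors, then so are all twelve `G w − 2⟪G w, m⟫ m` (the three mirror balls avoid `x` by non-capping). -/
theorem mirror_mem_module_of_twinReading {q : EuclideanSpace ℝ (Fin 3)} (hq : q ∈ Y) (hqx : q ≠ x)
    (hq2 : dist (0 : EuclideanSpace ℝ (Fin 3)) q ≤ 2) {G : EuclideanSpace ℝ (Fin 3) ≃ₗᵢ[ℝ] EuclideanSpace ℝ (Fin 3)}
    {m : EuclideanSpace ℝ (Fin 3)} (htw : IsTwinReading Y G m q) (hG : ∀ w ∈ fccSlots, G w ∈ coaxialModule 1 (Real.sqrt (2 / 3))) :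
    ∀ w ∈ fccSlots, G w - (2 * ⟪G w, m⟫_ℝ) • m ∈ coaxialModule 1 (Real.sqrt (2 / 3)) := by
  obtain ⟨⟨hm1, hmn⟩, -, hmir, -⟩ := htw
  have hqM : q ∈ coaxialModule 1 (Real.sqrt (2 / 3)) := hmod q hq (by linarith) hqx
  set M : EuclideanSpace ℝ (Fin 3) ≃ₗᵢ[ℝ] EuclideanSpace ℝ (Fin 3) := (ℝ ∙ m)ᗮ.reflection with hM
  have hMapp : ∀ y, M y = y - (2 * ⟪y, m⟫_ℝ) • m := fun y => by rw [hM, reflection_unit_apply hm1]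
  -- the lower triple for `m` = the far triple for `−m`
  have hm1' : ‖-m‖ = 1 := by rw [norm_neg, hm1]
  have hmn' : ∀ w ∈ fccSlots, ⟪G w, -m⟫_ℝ = 0 ∨ ⟪G w, -m⟫_ℝ = Real.sqrt (2 / 3) ∨ ⟪G w, -m⟫_ℝ = -Real.sqrt (2 / 3) := by
    intro w hw
    rcases hmn w hw with h0 | h0 | h0
    · exact Or.inl (by rw [inner_neg_right, h0, neg_zero])
    · exact Or.inr (Or.inr (by rw [inner_neg_right, h0]))
    · exact Or.inr (Or.inl (by rw [inner_neg_right, h0, neg_neg]))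
  have hrt : 0 < Real.sqrt (2 / 3) := Real.sqrt_pos.2 (by norm_num)
  obtain ⟨u₁, hu₁, u₂, hu₂, u₃, hu₃, n1, n2, n3, h12, h13, h23, -, honly⟩ := exists_far_frame G hm1' hmn'
  have neg_of : ∀ {w : EuclideanSpace ℝ (Fin 3)}, ⟪G w, -m⟫_ℝ = Real.sqrt (2 / 3) → ⟪G w, m⟫_ℝ < 0 := by
    intro w hw; rw [inner_neg_right] at hw; linarith
  -- the three mirror balls
  have p1 := hmir u₁ hu₁ (neg_of n1)
  have p2 := hmir u₂ hu₂ (neg_of n2)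
  have p3 := hmir u₃ hu₃ (neg_of n3)
  have dq : ∀ {u : EuclideanSpace ℝ (Fin 3)}, u ∈ fccSlots → dist q (q + (G u - (2 * ⟪G u, m⟫_ℝ) • m)) = 1 := by
    intro u hu
    rw [dist_add_right_eq]
    exact norm_sub_two_inner_smul_eq_one (by rw [LinearIsometryEquiv.norm_map]; exact norm_eq_one_of_mem_fccSlots hu) hm1
  have dd : ∀ {u u' : EuclideanSpace ℝ (Fin 3)}, u ∈ fccSlots → u' ∈ fccSlots → ⟪u, u'⟫_ℝ = 1 / 2 →
      dist (q + (G u - (2 * ⟪G u, m⟫_ℝ) • m)) (q + (G u' - (2 * ⟪G u', m⟫_ℝ) • m)) = 1 := by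
    intro u u' hu hu' h
    rw [← hMapp, ← hMapp, dist_eq_norm, add_sub_add_left_eq_sub, ← map_sub, ← map_sub, LinearIsometryEquiv.norm_map,
      LinearIsometryEquiv.norm_map]
    exact norm_eq_one_of_mem_fccSlots (sub_mem_fccSlots_of_inner_eq_half hu hu' h)
  have h21 : ⟪u₂, u₁⟫_ℝ = 1 / 2 := by rw [real_inner_comm]; exact h12
  have h31 : ⟪u₃, u₁⟫_ℝ = 1 / 2 := by rw [real_inner_comm]; exact h13
  have h32 : ⟪u₃, u₂⟫_ℝ = 1 / 2 := by rw [real_inner_comm]; exact h23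
  have key : ∀ {a b c : EuclideanSpace ℝ (Fin 3)}, a ∈ fccSlots → b ∈ fccSlots → c ∈ fccSlots →
      ⟪a, b⟫_ℝ = 1 / 2 → ⟪a, c⟫_ℝ = 1 / 2 → ⟪b, c⟫_ℝ = 1 / 2 →
      q + (G b - (2 * ⟪G b, m⟫_ℝ) • m) ∈ Y → q + (G c - (2 * ⟪G c, m⟫_ℝ) • m) ∈ Y → q + (G a - (2 * ⟪G a, m⟫_ℝ) • m) ≠ x := by
    intro a b c ha hb hc hab hac hbc hob hoc h
    refine hcap q hq _ hob _ hoc (dq hb) (dq hc) (dd hb hc hbc) ?_ ?_ ?_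
    · rw [← h, dist_comm]; exact dq ha
    · rw [← h]; exact dd ha hb hab
    · rw [← h]; exact dd ha hc hac
  have ne1 := key hu₁ hu₂ hu₃ h12 h13 h23 p2 p3
  have ne2 := key hu₂ hu₁ hu₃ h21 h23 h13 p1 p3
  have ne3 := key hu₃ hu₁ hu₂ h31 h32 h12 p1 p2
  have far : ∀ {u : EuclideanSpace ℝ (Fin 3)}, u ∈ fccSlots → dist (0 : EuclideanSpace ℝ (Fin 3)) (q + (G u - (2 * ⟪G u, m⟫_ℝ) • m)) ≤ 3 := by
    intro u hu
    linarith [dist_triangle (0 : EuclideanSpace ℝ (Fin 3)) q (q + (G u - (2 * ⟪G u, m⟫_ℝ) • m)), dq hu]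
  have modOf : ∀ {u : EuclideanSpace ℝ (Fin 3)}, u ∈ fccSlots → q + (G u - (2 * ⟪G u, m⟫_ℝ) • m) ∈ Y →
      q + (G u - (2 * ⟪G u, m⟫_ℝ) • m) ≠ x → G u - (2 * ⟪G u, m⟫_ℝ) • m ∈ coaxialModule 1 (Real.sqrt (2 / 3)) := by
    intro u hu ho hne
    have := sub_mem_module (hmod _ ho (far hu) hne) hqM
    rwa [add_sub_cancel_left] at this
  have l1 := modOf hu₁ p1 ne1
  have l2 := modOf hu₂ p2 ne2
  have l3 := modOf hu₃ p3 ne3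
  -- every slot: in-plane (fixed), lower (one of the three), upper (negative of a lower)
  intro w hw
  rcases hmn w hw with h0 | hpos | hneg
  · rw [h0, mul_zero, zero_smul, sub_zero]; exact hG w hw
  · -- upper slot: `−w` is a lower slot
    have hnw : -w ∈ fccSlots := neg_mem_fccSlots hw
    have hn' : ⟪G (-w), -m⟫_ℝ = Real.sqrt (2 / 3) := by rw [map_neg, inner_neg_left, inner_neg_right, neg_neg, hpos]
    have e : G w - (2 * ⟪G w, m⟫_ℝ) • m = -(G (-w) - (2 * ⟪G (-w), m⟫_ℝ) • m) := by
      rw [map_neg, inner_neg_left, mul_neg, neg_smul, sub_neg_eq_add, neg_add, neg_neg, sub_eq_add_neg]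
    rw [e]
    refine neg_mem_module ?_
    rcases honly (-w) hnw (by rw [hn']; exact hrt) with h | h | h
    · rw [h]; exact l1
    · rw [h]; exact l2
    · rw [h]; exact l3
  · have hn' : ⟪G w, -m⟫_ℝ = Real.sqrt (2 / 3) := by rw [inner_neg_right, hneg, neg_neg]
    rcases honly w hw (by rw [hn']; exact hrt) with h | h | h
    · rw [h]; exact l1
    · rw [h]; exact l2
    · rw [h]; exact l3

end Window


end TailResidue

end Summit.Ventures.Crystal3D.Theorems

end
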